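import Summits.ResolutionOfSingularities.ResolutionOfSingularities.Theorems.FrobeniusLadderFInjectiveMacaulayficationGradedChartClause
import Summits.ResolutionOfSingularities.ResolutionOfSingularities.Theorems.FrobeniusLadderFInjectiveMacaulayficationFilteredChartClauseV
import Summits.ResolutionOfSingularities.ResolutionOfSingularities.Theorems.FrobeniusLadderFInjectiveMacaulayficationWeightedConeCore
import HarnessLib

/-!
# T-𝒫 plug-ins: THE GRADED AND THE FILTERED ENGINE IN CERTIFICATE FORMAT (CRUX-PLAN w45a v10 §2.3 (c))
# (crux `FrobeniusLadder.FInjectiveMacaulayfication` stmt-ResolutionOfSingularities-15315, chain w45a; programme T-𝒫 «engine-class door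
# theorem», planner file `L/w45a/ClassGlueSig.lean` v2 239444958d057f2d; lead seat res-L1-w45a-lead-1 gen 3)

[OURS · L1 W4.5a] AI-written; AI review is weaker than expert review. NOT a statement of any manuscript; no named fact.

The T-𝒫 door consumes, at each bad point, a CERTIFICATE in E6‴'s format for an affine chart ring `R`, a centre `I ≠ 0` and a
finite family `v` in `I`:  `CERT(R, I, v)` := (Rees cover) `irrelevant (reesGrading I) ≤ √(span (reesT (v j)))` ∧ (`∀ j, v j ≠ 0`) ∧
(chart clause) `∀ j, ∀ Q` maximal in `R[I/v_j]` with `v_j/1 ∈ Q`, the Cohen–Macaulay + Frobenius-closed clause at `(R[I/v_j])_Q` —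
together with the zero locus of `I`. The CN engine's certificates are stub-5's §3b. This file EXPOSES THE `hon`/`hcov` BLOCKS OF THE
LEAD'S TWO ENGINES in exactly that format, for `R = k[X]/(f)`, `I = I_N·R` (weighted centre, weights all positive — the
point-supported case the door needs), `v j = x̄_j^{c_j}`:
* `gradedCertificates` — class A (weighted-homogeneous `f`; chart clause = G4 `GradedChartClause.stub_gradedChartClause` p488482 from
  the clause of the punctured cone);
* `filteredCertificates` — class ♮ (ARBITRARY `f` with initial form `f₀`; chart clause = G4♮ᵛ `FilteredChartClauseV.filteredChartClause_v`
  p504066 from the clause of the punctured TANGENT cone `k[X]/(f₀)` — NO hypothesis on `R` itself off the origin);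
* shared: `X_pow_mem_centre` (`x̄_j^{c_j} ∈ I`), `centre_ne_bot`, `centre_le_iff` (zero locus: `I ≤ P ↔ ∀ i, x̄ᵢ ∈ P`), `reesCover_centre`
  (the cover inequality — the `hcov` block of `WeightedConeCore.weightedConeFiModel_of_chartClause` p460946 as a lemma).
No definitions, no named facts. [folklore]
-/

set_option linter.dupNamespace false

noncomputable section

open Literature.AlgebraicGeometry.Resolution AlgebraicGeometry MvPolynomial

namespace Summit.ResolutionOfSingularities.ResolutionOfSingularities.Theorems.FInjectiveMacaulayfication.GradedFilteredCertificates

open Summit.ResolutionOfSingularities.ResolutionOfSingularities.Theorems.FInjectiveMacaulayfication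
open WeightedConeCore

variable {k : Type} [Field k] {n : ℕ}

/-- `x̄_j ^ c_j ∈ I_N · R` when `c_j · w_j = N`. [folklore] -/
theorem X_pow_mem_centre (w : Fin n → ℕ) (N : ℕ) (c : Fin n → ℕ) (hwc : ∀ v : Fin n, 0 < w v ∧ c v * w v = N)
    (f : MvPolynomial (Fin n) k) (j : Fin n) :
    Ideal.Quotient.mk (Ideal.span {f}) (MvPolynomial.X j) ^ c j ∈
      (Ideal.span {m : MvPolynomial (Fin n) k | ∃ b : Fin n →₀ ℕ, N ≤ Finsupp.weight w b ∧
        m = MvPolynomial.monomial b 1}).map (Ideal.Quotient.mk (Ideal.span {f})) := by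
  rw [← map_pow, X_pow_eq_monomial]
  refine Ideal.mem_map_of_mem _ (monomial_mem_weightIdeal w N _ ?_)
  rw [Finsupp.weight_single, smul_eq_mul, (hwc j).2]

/-- The centre `I_N · R` is non-zero (`n > 0`, no `x̄_j = 0`). [folklore] -/
theorem centre_ne_bot (w : Fin n → ℕ) (N : ℕ) (c : Fin n → ℕ) (hwc : ∀ v : Fin n, 0 < w v ∧ c v * w v = N) (hn : 0 < n)
    (f : MvPolynomial (Fin n) k) (hfprime : (Ideal.span {f}).IsPrime)
    (hXne : ∀ v : Fin n, Ideal.Quotient.mk (Ideal.span {f}) (MvPolynomial.X v) ≠ 0) :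
    (Ideal.span {m : MvPolynomial (Fin n) k | ∃ b : Fin n →₀ ℕ, N ≤ Finsupp.weight w b ∧
        m = MvPolynomial.monomial b 1}).map (Ideal.Quotient.mk (Ideal.span {f})) ≠ ⊥ := fun h => by
  haveI := hfprime
  haveI : IsDomain (MvPolynomial (Fin n) k ⧸ Ideal.span {f}) := Ideal.Quotient.isDomain _
  have hmem := X_pow_mem_centre (k := k) w N c hwc f ⟨0, hn⟩
  rw [h, Ideal.mem_bot] at hmem
  exact pow_ne_zero _ (hXne ⟨0, hn⟩) hmem

/-- **Zero locus of the weighted centre**: for a prime `P` of `R = k[X]/(f)`, `I_N · R ≤ P ↔ ∀ i, x̄ᵢ ∈ P` (`N > 0`, all `c_i w_i = N`).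
[folklore] -/
theorem centre_le_iff (w : Fin n → ℕ) (N : ℕ) (c : Fin n → ℕ) (hN : 0 < N) (hwc : ∀ v : Fin n, 0 < w v ∧ c v * w v = N)
    (f : MvPolynomial (Fin n) k) (P : Ideal (MvPolynomial (Fin n) k ⧸ Ideal.span {f})) [P.IsPrime] :
    (Ideal.span {m : MvPolynomial (Fin n) k | ∃ b : Fin n →₀ ℕ, N ≤ Finsupp.weight w b ∧
        m = MvPolynomial.monomial b 1}).map (Ideal.Quotient.mk (Ideal.span {f})) ≤ P ↔
      ∀ i : Fin n, Ideal.Quotient.mk (Ideal.span {f}) (MvPolynomial.X i) ∈ P := by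
  constructor
  · intro h i
    exact ‹P.IsPrime›.mem_of_pow_mem _ (h (X_pow_mem_centre (k := k) w N c hwc f i))
  · intro h
    have hIle : (Ideal.span {m : MvPolynomial (Fin n) k | ∃ b : Fin n →₀ ℕ, N ≤ Finsupp.weight w b ∧
        m = MvPolynomial.monomial b 1}).map (Ideal.Quotient.mk (Ideal.span {f})) ≤
        Ideal.span (Set.range fun j : Fin n => Ideal.Quotient.mk (Ideal.span {f}) (MvPolynomial.X j)) := by
      rw [show (Set.range fun j : Fin n => Ideal.Quotient.mk (Ideal.span {f}) (MvPolynomial.X j)) =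
        Ideal.Quotient.mk (Ideal.span {f}) '' Set.range (fun j : Fin n => (X j : MvPolynomial (Fin n) k)) from
        by rw [← Set.range_comp]; rfl, ← Ideal.map_span]
      exact Ideal.map_mono (weightIdeal_le_span_X w N hN)
    refine hIle.trans ?_
    rw [Ideal.span_le]
    rintro _ ⟨i, rfl⟩
    exact h i

/-- **The Rees cover of the weighted centre by the pure powers `x̄_j^{c_j}`** (the `hcov` block of `WeightedConeCore` p460946, exposed):
every generator `x̄^b` (`wt b ≥ N`) satisfies `(x̄^b)^{c_j} = x̄_j^{c_j} · x̄^{b'}` with `x̄^{b'} ∈ I^{c_j - 1}` for a variable `j` of `b`,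
by Veronese saturation. [folklore] -/
theorem reesCover_centre (w : Fin n → ℕ) (N : ℕ) (c : Fin n → ℕ) (hN : 0 < N) (hwc : ∀ v : Fin n, 0 < w v ∧ c v * w v = N)
    (hpow : ∀ (K : ℕ) (b : Fin n →₀ ℕ), K * N ≤ Finsupp.weight w b →
      (MvPolynomial.monomial b (1 : k) : MvPolynomial (Fin n) k) ∈
        (Ideal.span {m : MvPolynomial (Fin n) k | ∃ b : Fin n →₀ ℕ, N ≤ Finsupp.weight w b ∧
          m = MvPolynomial.monomial b 1}) ^ K)
    (f : MvPolynomial (Fin n) k) :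
    (HomogeneousIdeal.irrelevant (reesGrading ((Ideal.span {m : MvPolynomial (Fin n) k | ∃ b : Fin n →₀ ℕ,
        N ≤ Finsupp.weight w b ∧ m = MvPolynomial.monomial b 1}).map (Ideal.Quotient.mk (Ideal.span {f}))))).toIdeal ≤
      (Ideal.span (Set.range fun j : Fin n => reesT (I := (Ideal.span {m : MvPolynomial (Fin n) k | ∃ b : Fin n →₀ ℕ,
        N ≤ Finsupp.weight w b ∧ m = MvPolynomial.monomial b 1}).map (Ideal.Quotient.mk (Ideal.span {f})))
        (Ideal.Quotient.mk (Ideal.span {f}) (MvPolynomial.X j) ^ c j) (X_pow_mem_centre w N c hwc f j))).radical := by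
  have hc : ∀ j : Fin n, 0 < c j := fun j => Nat.pos_of_ne_zero fun h => by
    have h2 := (hwc j).2
    rw [h, zero_mul] at h2
    omega
  refine ReesCoverOfPowers.stub_reesCoverOfPowers _ _
    (Ideal.Quotient.mk (Ideal.span {f}) '' {m : MvPolynomial (Fin n) k | ∃ b : Fin n →₀ ℕ,
      N ≤ Finsupp.weight w b ∧ m = MvPolynomial.monomial b 1}) (by rw [Ideal.map_span]) n _ _ ?_
  rintro _ ⟨_, ⟨b, hb, rfl⟩, rfl⟩
  -- `b ≠ 0`: pick a variable `j` occurring in `b`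
  obtain ⟨j, hj⟩ : ∃ j, b j ≠ 0 := by
    by_contra h
    push Not at h
    have hb0 : b = 0 := Finsupp.ext h
    subst hb0
    simp at hb
    omega
  have hle : Finsupp.single j (c j) ≤ c j • b := Finsupp.single_le_iff.mpr (by
    rw [Finsupp.smul_apply, smul_eq_mul]
    exact Nat.le_mul_of_pos_right _ (Nat.pos_of_ne_zero hj))
  have hsplit : c j • b = Finsupp.single j (c j) + (c j • b - Finsupp.single j (c j)) := by
    rw [add_comm, tsub_add_cancel_of_le hle]
  refine ⟨j, c j, hc j, Ideal.Quotient.mk (Ideal.span {f})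
    (MvPolynomial.monomial (c j • b - Finsupp.single j (c j)) 1), ?_, ?_⟩
  · -- `x̄^{b'} ∈ I ^ (c_j - 1)` by the Veronese saturation hypothesis
    rw [← Ideal.map_pow]
    refine Ideal.mem_map_of_mem _ (hpow (c j - 1) _ ?_)
    have hwt : Finsupp.weight w (c j • b) =
        N + Finsupp.weight w (c j • b - Finsupp.single j (c j)) := by
      conv_lhs => rw [hsplit]
      rw [map_add, Finsupp.weight_single, smul_eq_mul, (hwc j).2]
    have hwt' : Finsupp.weight w (c j • b) = c j * Finsupp.weight w b := by
      rw [map_nsmul, smul_eq_mul]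
    have h1 : c j * N ≤ c j * Finsupp.weight w b := Nat.mul_le_mul_left _ hb
    have h2 : (c j - 1) * N + N = c j * N := by
      rcases Nat.exists_eq_succ_of_ne_zero (hc j).ne' with ⟨e, he⟩
      rw [he, Nat.succ_sub_one, Nat.succ_mul]
    omega
  · -- the identity `(x̄^b)^{c_j} = x̄ⱼ^{c_j} · x̄^{b'}`
    rw [← map_pow (Ideal.Quotient.mk (Ideal.span {f})) (X j),
      ← map_pow (Ideal.Quotient.mk (Ideal.span {f})) (MvPolynomial.monomial b (1 : k)), ← map_mul]
    congr 1
    rw [MvPolynomial.monomial_pow, one_pow, X_pow_eq_monomial, MvPolynomial.monomial_mul, one_mul, ← hsplit]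

/-- **CLASS A (graded) IN CERTIFICATE FORMAT.** For the weighted-homogeneous prime hypersurface `R = k[X]/(f)` with the clause off
the origin (punctured cone), the centre `I = I_N·R` and the family `v j = x̄_j^{c_j}` satisfy E6‴'s certificate `CERT(R, I, v)`,
`I ≠ 0`, and `V(I) = {origin}` — the inputs of the T-𝒫 door for a bad point with a class-A chart. [folklore] -/
theorem gradedCertificates (p : ℕ) [Fact p.Prime] (k : Type) [Field k] [CharP k p] (n : ℕ) (hn : 0 < n)
    (w : Fin n → ℕ) (N : ℕ) (c : Fin n → ℕ) (hN : 0 < N) (hwc : ∀ v : Fin n, 0 < w v ∧ c v * w v = N)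
    (hpow : ∀ (K : ℕ) (b : Fin n →₀ ℕ), K * N ≤ Finsupp.weight w b →
      (MvPolynomial.monomial b (1 : k) : MvPolynomial (Fin n) k) ∈
        (Ideal.span {m : MvPolynomial (Fin n) k | ∃ b : Fin n →₀ ℕ, N ≤ Finsupp.weight w b ∧
          m = MvPolynomial.monomial b 1}) ^ K)
    (f : MvPolynomial (Fin n) k) (D : ℕ) (hf : MvPolynomial.IsWeightedHomogeneous w f D)
    (hfprime : (Ideal.span {f}).IsPrime)
    (hXne : ∀ v : Fin n, Ideal.Quotient.mk (Ideal.span {f}) (MvPolynomial.X v) ≠ 0)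
    (hoff : ∀ (Q : Ideal (MvPolynomial (Fin n) k ⧸ Ideal.span {f})) [Q.IsMaximal],
      (∃ j : Fin n, Ideal.Quotient.mk (Ideal.span {f}) (MvPolynomial.X j) ∉ Q) →
      ∀ d : ℕ, ringKrullDim (Localization.AtPrime Q) = d → ∀ s : Fin d → Localization.AtPrime Q,
        (Ideal.span (Set.range s)).radical.IsMaximal →
          RingTheory.Sequence.IsWeaklyRegular (Localization.AtPrime Q) (List.ofFn s) ∧
          ∀ y : Localization.AtPrime Q, (∃ e : ℕ, y ^ p ^ e ∈ Ideal.span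
            ((fun z : Localization.AtPrime Q => z ^ p ^ e) ''
              (Ideal.span (Set.range s) : Set (Localization.AtPrime Q)))) → y ∈ Ideal.span (Set.range s)) :
    (Ideal.span {m : MvPolynomial (Fin n) k | ∃ b : Fin n →₀ ℕ, N ≤ Finsupp.weight w b ∧
        m = MvPolynomial.monomial b 1}).map (Ideal.Quotient.mk (Ideal.span {f})) ≠ ⊥ ∧
    ((HomogeneousIdeal.irrelevant (reesGrading ((Ideal.span {m : MvPolynomial (Fin n) k | ∃ b : Fin n →₀ ℕ,
        N ≤ Finsupp.weight w b ∧ m = MvPolynomial.monomial b 1}).map (Ideal.Quotient.mk (Ideal.span {f}))))).toIdeal ≤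
      (Ideal.span (Set.range fun j : Fin n => reesT (I := (Ideal.span {m : MvPolynomial (Fin n) k | ∃ b : Fin n →₀ ℕ,
        N ≤ Finsupp.weight w b ∧ m = MvPolynomial.monomial b 1}).map (Ideal.Quotient.mk (Ideal.span {f})))
        (Ideal.Quotient.mk (Ideal.span {f}) (MvPolynomial.X j) ^ c j) (X_pow_mem_centre w N c hwc f j))).radical ∧
      (∀ j : Fin n, Ideal.Quotient.mk (Ideal.span {f}) (MvPolynomial.X j) ^ c j ≠ 0) ∧
      ∀ (j : Fin n) (Q : Ideal (blowupAlgebra ((Ideal.span {m : MvPolynomial (Fin n) k | ∃ b : Fin n →₀ ℕ,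
          N ≤ Finsupp.weight w b ∧ m = MvPolynomial.monomial b 1}).map (Ideal.Quotient.mk (Ideal.span {f})))
          (Ideal.Quotient.mk (Ideal.span {f}) (MvPolynomial.X j) ^ c j))) [Q.IsMaximal],
        algebraMap (MvPolynomial (Fin n) k ⧸ Ideal.span {f}) (blowupAlgebra ((Ideal.span {m : MvPolynomial (Fin n) k |
          ∃ b : Fin n →₀ ℕ, N ≤ Finsupp.weight w b ∧ m = MvPolynomial.monomial b 1}).map (Ideal.Quotient.mk (Ideal.span {f})))
          (Ideal.Quotient.mk (Ideal.span {f}) (MvPolynomial.X j) ^ c j)) (Ideal.Quotient.mk (Ideal.span {f}) (MvPolynomial.X j) ^ c j) ∈ Q →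
        ∀ d : ℕ, ringKrullDim (Localization.AtPrime Q) = d → ∀ s : Fin d → Localization.AtPrime Q,
          (Ideal.span (Set.range s)).radical.IsMaximal →
            RingTheory.Sequence.IsWeaklyRegular (Localization.AtPrime Q) (List.ofFn s) ∧
            ∀ y : Localization.AtPrime Q, (∃ e : ℕ, y ^ p ^ e ∈ Ideal.span
              ((fun z : Localization.AtPrime Q => z ^ p ^ e) ''
                (Ideal.span (Set.range s) : Set (Localization.AtPrime Q)))) → y ∈ Ideal.span (Set.range s)) ∧
    (∀ (P : Ideal (MvPolynomial (Fin n) k ⧸ Ideal.span {f})) [P.IsPrime],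
      (Ideal.span {m : MvPolynomial (Fin n) k | ∃ b : Fin n →₀ ℕ, N ≤ Finsupp.weight w b ∧
          m = MvPolynomial.monomial b 1}).map (Ideal.Quotient.mk (Ideal.span {f})) ≤ P ↔
        ∀ i : Fin n, Ideal.Quotient.mk (Ideal.span {f}) (MvPolynomial.X i) ∈ P) := by
  haveI := hfprime
  haveI : IsDomain (MvPolynomial (Fin n) k ⧸ Ideal.span {f}) := Ideal.Quotient.isDomain _
  have hc : ∀ j : Fin n, 0 < c j := fun j => Nat.pos_of_ne_zero fun h => by
    have h2 := (hwc j).2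
    rw [h, zero_mul] at h2
    omega
  refine ⟨centre_ne_bot w N c hwc hn f hfprime hXne, ⟨reesCover_centre w N c hN hwc hpow f, fun j => pow_ne_zero _ (hXne j), ?_⟩,
    fun P _ => centre_le_iff w N c hN hwc f P⟩
  intro j Q _ hQ
  exact GradedChartClause.stub_gradedChartClause p k n w j (hwc j).1 N (c j) D (hwc j).2 (hc j) hpow f hf hfprime hXne hoff Q hQ

/-- **CLASS ♮ (filtered) IN CERTIFICATE FORMAT.** For an ARBITRARY prime hypersurface `R = k[X]/(f)` (no `x̄_j = 0`) whose weighted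
TANGENT CONE `k[X]/(f₀)`, `f₀ = in_w f`, satisfies the clause at its maximal ideals missing a variable, the centre `I = I_N·R` and
the family `v j = x̄_j^{c_j}` satisfy `CERT(R, I, v)`, `I ≠ 0`, `V(I) = {origin}` — with NO hypothesis on `R` off the origin (the T-𝒫
door reads off-centre goodness from `X₁` itself). Chart clause = G4♮ᵛ `FilteredChartClauseV.filteredChartClause_v`. [folklore] -/
theorem filteredCertificates (p : ℕ) [Fact p.Prime] (k : Type) [Field k] [CharP k p] (n : ℕ) (hn : 0 < n)
    (w : Fin n → ℕ) (N D : ℕ) (c : Fin n → ℕ) (hN : 0 < N) (hwc : ∀ v : Fin n, 0 < w v ∧ c v * w v = N)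
    (hpow : ∀ (K : ℕ) (b : Fin n →₀ ℕ), K * N ≤ Finsupp.weight w b →
      (MvPolynomial.monomial b (1 : k) : MvPolynomial (Fin n) k) ∈
        (Ideal.span {m : MvPolynomial (Fin n) k | ∃ b : Fin n →₀ ℕ, N ≤ Finsupp.weight w b ∧
          m = MvPolynomial.monomial b 1}) ^ K)
    (f f₀ : MvPolynomial (Fin n) k) (hf₀ : f₀ = MvPolynomial.weightedHomogeneousComponent w D f)
    (hD0 : ∀ m < D, MvPolynomial.weightedHomogeneousComponent w m f = 0) (hD : f₀ ≠ 0)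
    (hfprime : (Ideal.span {f}).IsPrime)
    (hXne : ∀ v : Fin n, Ideal.Quotient.mk (Ideal.span {f}) (MvPolynomial.X v) ≠ 0)
    (hoff₀ : ∀ (Q : Ideal (MvPolynomial (Fin n) k ⧸ Ideal.span {f₀})) [Q.IsMaximal],
      (∃ j : Fin n, Ideal.Quotient.mk (Ideal.span {f₀}) (MvPolynomial.X j) ∉ Q) →
      ∀ d : ℕ, ringKrullDim (Localization.AtPrime Q) = d → ∀ s : Fin d → Localization.AtPrime Q,
        (Ideal.span (Set.range s)).radical.IsMaximal →
          RingTheory.Sequence.IsWeaklyRegular (Localization.AtPrime Q) (List.ofFn s) ∧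
          ∀ y : Localization.AtPrime Q, (∃ e : ℕ, y ^ p ^ e ∈ Ideal.span
            ((fun z : Localization.AtPrime Q => z ^ p ^ e) ''
              (Ideal.span (Set.range s) : Set (Localization.AtPrime Q)))) → y ∈ Ideal.span (Set.range s)) :
    (Ideal.span {m : MvPolynomial (Fin n) k | ∃ b : Fin n →₀ ℕ, N ≤ Finsupp.weight w b ∧
        m = MvPolynomial.monomial b 1}).map (Ideal.Quotient.mk (Ideal.span {f})) ≠ ⊥ ∧
    ((HomogeneousIdeal.irrelevant (reesGrading ((Ideal.span {m : MvPolynomial (Fin n) k | ∃ b : Fin n →₀ ℕ,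
        N ≤ Finsupp.weight w b ∧ m = MvPolynomial.monomial b 1}).map (Ideal.Quotient.mk (Ideal.span {f}))))).toIdeal ≤
      (Ideal.span (Set.range fun j : Fin n => reesT (I := (Ideal.span {m : MvPolynomial (Fin n) k | ∃ b : Fin n →₀ ℕ,
        N ≤ Finsupp.weight w b ∧ m = MvPolynomial.monomial b 1}).map (Ideal.Quotient.mk (Ideal.span {f})))
        (Ideal.Quotient.mk (Ideal.span {f}) (MvPolynomial.X j) ^ c j) (X_pow_mem_centre w N c hwc f j))).radical ∧
      (∀ j : Fin n, Ideal.Quotient.mk (Ideal.span {f}) (MvPolynomial.X j) ^ c j ≠ 0) ∧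
      ∀ (j : Fin n) (Q : Ideal (blowupAlgebra ((Ideal.span {m : MvPolynomial (Fin n) k | ∃ b : Fin n →₀ ℕ,
          N ≤ Finsupp.weight w b ∧ m = MvPolynomial.monomial b 1}).map (Ideal.Quotient.mk (Ideal.span {f})))
          (Ideal.Quotient.mk (Ideal.span {f}) (MvPolynomial.X j) ^ c j))) [Q.IsMaximal],
        algebraMap (MvPolynomial (Fin n) k ⧸ Ideal.span {f}) (blowupAlgebra ((Ideal.span {m : MvPolynomial (Fin n) k |
          ∃ b : Fin n →₀ ℕ, N ≤ Finsupp.weight w b ∧ m = MvPolynomial.monomial b 1}).map (Ideal.Quotient.mk (Ideal.span {f})))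
          (Ideal.Quotient.mk (Ideal.span {f}) (MvPolynomial.X j) ^ c j)) (Ideal.Quotient.mk (Ideal.span {f}) (MvPolynomial.X j) ^ c j) ∈ Q →
        ∀ d : ℕ, ringKrullDim (Localization.AtPrime Q) = d → ∀ s : Fin d → Localization.AtPrime Q,
          (Ideal.span (Set.range s)).radical.IsMaximal →
            RingTheory.Sequence.IsWeaklyRegular (Localization.AtPrime Q) (List.ofFn s) ∧
            ∀ y : Localization.AtPrime Q, (∃ e : ℕ, y ^ p ^ e ∈ Ideal.span
              ((fun z : Localization.AtPrime Q => z ^ p ^ e) ''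
                (Ideal.span (Set.range s) : Set (Localization.AtPrime Q)))) → y ∈ Ideal.span (Set.range s)) ∧
    (∀ (P : Ideal (MvPolynomial (Fin n) k ⧸ Ideal.span {f})) [P.IsPrime],
      (Ideal.span {m : MvPolynomial (Fin n) k | ∃ b : Fin n →₀ ℕ, N ≤ Finsupp.weight w b ∧
          m = MvPolynomial.monomial b 1}).map (Ideal.Quotient.mk (Ideal.span {f})) ≤ P ↔
        ∀ i : Fin n, Ideal.Quotient.mk (Ideal.span {f}) (MvPolynomial.X i) ∈ P) := by
  haveI := hfprime
  haveI : IsDomain (MvPolynomial (Fin n) k ⧸ Ideal.span {f}) := Ideal.Quotient.isDomain _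
  have hc : ∀ j : Fin n, 0 < c j := fun j => Nat.pos_of_ne_zero fun h => by
    have h2 := (hwc j).2
    rw [h, zero_mul] at h2
    omega
  refine ⟨centre_ne_bot w N c hwc hn f hfprime hXne, ⟨reesCover_centre w N c hN hwc hpow f, fun j => pow_ne_zero _ (hXne j), ?_⟩,
    fun P _ => centre_le_iff w N c hN hwc f P⟩
  intro j Q _ hQ
  exact FilteredChartClauseV.filteredChartClause_v p k n w j (hwc j).1 N (c j) D (hwc j).2 (hc j) hpow f f₀ hf₀ hD0 hD hfprime hXne
    (fun Q' _ hj => hoff₀ Q' ⟨j, hj⟩) Q hQ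

end Summit.ResolutionOfSingularities.ResolutionOfSingularities.Theorems.FInjectiveMacaulayfication.GradedFilteredCertificates

end
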